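import Literature.NumberTheory.Sieve.SmoothPolylogRegimeScales
import Literature.NumberTheory.Sieve.SmoothSaddlePointApprox
import HarnessLib

/-!
# The polylog regime `y = ⌊(log x)^{100000}⌋` at all REAL scales `z ∈ [√x, x]`, and small analytic lemmas

Topic `Literature/NumberTheory/Sieve`; a PROVED tool file (bookkeeping of limits only) for the zeroth-order asymptotic of
the parity-class friable ternary counts (`SmoothParityAsymptotic`, [Harper2016, §5]).  `polylog_regime_at_scales`
(`SmoothPolylogRegimeScales`) gives Harper's side conditions at every NATURAL scale `z ∈ [√x, x]`; the circle method at the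
scales `X_i = x/e_i` needs them at REAL scales, together with two facts at the doubled scale `2X_i` (the ambient scale of the
free variable's minor-arc bound):

* `polylog_regime_real_scales` — for every threshold `z₀` and all large real `x`, every real `z` with `√x ≤ z ≤ x` has
  `z ≥ z₀`, `(log z)⁸ ≤ y`, `log y ≤ ½ (log z)^{1/6}`, `y^{200} ≤ z`, `α(z, y) ≥ 1 − 10⁻⁴`, `Ψ(z, y) ≥ z^{39999/40000}`,
  `(log 2z)⁸ ≤ y` and `α(2z, y) ≥ 1 − 10⁻⁴` (`y = ⌊(log x)^{100000}⌋`; the saddle-point bound at the natural scale `⌈2x⌉`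
  and `saddlePoint_antitone`; the count at `⌊z⌋` with a slightly better exponent);
* `fifth_le_saddlePhi₂` — `φ₂(σ, y) ≥ 1/5` for `0 < σ ≤ 2` (the prime `2` alone);
* `one_le_smoothZeta` — `ζ(σ, y) ≥ 1`;
* `tendsto_loglog_sq_div_log`, `tendsto_log_rpow_neg` — the decay rates `(log log x)²/log x`, `(log x)^{−a} → 0`
  (`(log x)^n x^{−s} → 0` is `DH97.tendsto_log_pow_mul_rpow_neg` / `isLittleO_log_rpow_rpow_atTop`).

## References

* A. J. Harper, Compositio Math. 152 (2016), §2.1 and §5 [Harper2016].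
* A. Hildebrand, G. Tenenbaum, Trans. AMS 296 (1986), Thm 2 [HildebrandTenenbaum1986].
-/

noncomputable section

open Finset Filter Real Topology

namespace Literature.NumberTheory.Sieve

/-! ### Small lemmas on `φ₂` and `ζ(σ, y)` -/

/-- `φ₂(σ, y) ≥ 1/5` for `0 < σ ≤ 2`, `y ≥ 2`: the term of the prime `2` alone is `log²2 · u/(u − 1)²` with
`u = 2^σ ∈ (1, 4]`, and `u/(u−1)² ≥ 4/9`, `log²2 ≥ 47/100`. [folklore] -/
theorem fifth_le_saddlePhi₂ {σ : ℝ} {y : ℕ} (hy : 2 ≤ y) (hσ0 : 0 < σ) (hσ2 : σ ≤ 2) : 1 / 5 ≤ saddlePhi₂ σ y := by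
  have h2 : 2 ∈ Nat.primesLE y := Nat.mem_primesLE.2 ⟨hy, Nat.prime_two⟩
  rw [saddlePhi₂_def]
  have hterm : ∀ p ∈ Nat.primesLE y, 0 ≤ Real.log p ^ 2 * ((p : ℝ) ^ σ / ((p : ℝ) ^ σ - 1) ^ 2) := by
    intro p hp
    have hp2 : (2 : ℝ) ≤ p := by exact_mod_cast (Nat.prime_of_mem_primesLE hp).two_le
    have : 0 ≤ (p : ℝ) ^ σ := Real.rpow_nonneg (by linarith) _
    positivity
  refine le_trans ?_ (Finset.single_le_sum hterm h2)
  have hu1 : 1 < (2 : ℝ) ^ σ := Real.one_lt_rpow one_lt_two hσ0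
  have hu4 : (2 : ℝ) ^ σ ≤ 4 := by
    calc (2 : ℝ) ^ σ ≤ (2 : ℝ) ^ (2 : ℝ) := Real.rpow_le_rpow_of_exponent_le one_le_two hσ2
      _ = 4 := by rw [Real.rpow_two]; norm_num
  have hfrac : 4 / 9 ≤ (2 : ℝ) ^ σ / ((2 : ℝ) ^ σ - 1) ^ 2 := by
    have hsub : 0 < (2 : ℝ) ^ σ - 1 := by linarith
    rw [div_le_div_iff₀ (by norm_num) (by positivity)]
    nlinarith [mul_nonneg (by linarith : (0 : ℝ) ≤ 4 * (2 : ℝ) ^ σ - 1) (by linarith : (0 : ℝ) ≤ 4 - (2 : ℝ) ^ σ)]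
  have hlog : 47 / 100 ≤ Real.log 2 ^ 2 := by nlinarith [Real.log_two_gt_d9]
  push_cast
  calc (1 : ℝ) / 5 ≤ 47 / 100 * (4 / 9) := by norm_num
    _ ≤ Real.log 2 ^ 2 * ((2 : ℝ) ^ σ / ((2 : ℝ) ^ σ - 1) ^ 2) := mul_le_mul hlog hfrac (by norm_num) (sq_nonneg _)

/-- `ζ(σ, y) = Π_{p ≤ y} (1 − p^{−σ})⁻¹ ≥ 1` for `σ > 0` (every factor is `≥ 1`). [folklore] -/
theorem one_le_smoothZeta {σ : ℝ} (hσ : 0 < σ) (y : ℕ) : 1 ≤ smoothZeta σ y := by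
  rw [smoothZeta_def]
  have h : ∀ p ∈ Nat.primesLE y, (1 : ℝ) ≤ (1 - (p : ℝ) ^ (-σ))⁻¹ := by
    intro p hp
    have hp2 : (2 : ℝ) ≤ p := by exact_mod_cast (Nat.prime_of_mem_primesLE hp).two_le
    have h1 : (p : ℝ) ^ (-σ) < 1 := Real.rpow_lt_one_of_one_lt_of_neg (by linarith) (by linarith)
    have h0 : 0 < (p : ℝ) ^ (-σ) := Real.rpow_pos_of_pos (by linarith) _
    rw [one_le_inv₀ (by linarith)]
    linarith
  calc (1 : ℝ) = ∏ _p ∈ Nat.primesLE y, (1 : ℝ) := Finset.prod_const_one.symm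
    _ ≤ _ := Finset.prod_le_prod (fun _ _ => zero_le_one) h

/-! ### Two decay rates -/

/-- `(log log x)²/log x → 0`. [folklore] -/
theorem tendsto_loglog_sq_div_log : Tendsto (fun x : ℝ => Real.log (Real.log x) ^ 2 / Real.log x) atTop (𝓝 0) := by
  have h := (isLittleO_pow_log_id_atTop (n := 2)).comp_tendsto Real.tendsto_log_atTop
  simpa [Function.comp_def] using h.tendsto_div_nhds_zero

/-- `(log x)^{−a} → 0` for `a > 0`. [folklore] -/
theorem tendsto_log_rpow_neg {a : ℝ} (ha : 0 < a) : Tendsto (fun x : ℝ => Real.log x ^ (-a)) atTop (𝓝 0) :=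
  (tendsto_rpow_neg_atTop ha).comp Real.tendsto_log_atTop

/-! ### The regime at real scales -/

namespace PolylogScales

/-- `(1 + log 3/L)^{K} ≤ 3/2` once `L ≥ 4K log 3` (`K ≥ 1`): `(1+t)^K ≤ e^{tK} ≤ 1 + 2tK`. [folklore] -/
theorem one_add_div_pow_le {L K : ℝ} (hK : 1 ≤ K) (hL : 4 * K * Real.log 3 ≤ L) :
    (1 + Real.log 3 / L) ^ K ≤ 3 / 2 := by
  have hl3 : 0 < Real.log 3 := Real.log_pos (by norm_num)
  have hL0 : 0 < L := lt_of_lt_of_le (by positivity) hL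
  set t : ℝ := Real.log 3 / L with ht
  have ht0 : 0 ≤ t := by positivity
  have htK : t * K ≤ 1 / 4 := by
    rw [ht, div_mul_eq_mul_div, div_le_iff₀ hL0]; linarith
  have h1 : (1 + t) ^ K ≤ Real.exp (t * K) := by
    calc (1 + t) ^ K ≤ Real.exp t ^ K := Real.rpow_le_rpow (by linarith) (by linarith [Real.add_one_le_exp t]) (by linarith)
      _ = Real.exp (t * K) := by rw [← Real.exp_mul]
  have h2 : Real.exp (t * K) ≤ 1 + 2 * (t * K) := by
    have h := Real.abs_exp_sub_one_le (x := t * K) (by rw [abs_of_nonneg (by positivity)]; linarith)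
    rw [abs_of_nonneg (by positivity : 0 ≤ t * K)] at h
    linarith [le_abs_self (Real.exp (t * K) - 1)]
  linarith

end PolylogScales

open PolylogScales

/-- **The polylog regime at all REAL scales `z ∈ [√x, x]`, with the doubled scale.**  For every threshold `z₀` and all large
real `x`, with `y = ⌊(log x)^{100000}⌋`, every real `z` with `√x ≤ z ≤ x` satisfies `z ≥ z₀`, `(log z)⁸ ≤ y`,
`log y ≤ ½ (log z)^{1/6}`, `y^{200} ≤ z`, `α(z, y) ≥ 1 − 10⁻⁴`, `Ψ(z, y) ≥ z^{39999/40000}`, `(log 2z)⁸ ≤ y` and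
`α(2z, y) ≥ 1 − 10⁻⁴`. [cite: Harper2016, §2.1 (2.1) and §5 (proof of Prop. 5)] -/
theorem polylog_regime_real_scales (z₀ : ℝ) :
    ∀ᶠ x : ℝ in atTop, ∀ z : ℝ, x ^ (1 / 2 : ℝ) ≤ z → z ≤ x →
      z₀ ≤ z ∧ Real.log z ^ 8 ≤ (⌊Real.log x ^ 100000⌋₊ : ℝ) ∧
      Real.log (⌊Real.log x ^ 100000⌋₊ : ℝ) ≤ 1 / 2 * Real.log z ^ (1 / 6 : ℝ) ∧
      ((⌊Real.log x ^ 100000⌋₊ : ℕ) : ℝ) ^ 200 ≤ z ∧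
      1 - 1 / 10000 ≤ saddlePoint z ⌊Real.log x ^ 100000⌋₊ ∧
      z ^ ((39999 : ℝ) / 40000) ≤ ((Nat.smoothNumbersUpTo ⌊z⌋₊ (⌊Real.log x ^ 100000⌋₊ + 1)).card : ℝ) ∧
      Real.log (2 * z) ^ 8 ≤ (⌊Real.log x ^ 100000⌋₊ : ℝ) ∧
      1 - 1 / 10000 ≤ saddlePoint (2 * z) ⌊Real.log x ^ 100000⌋₊ := by
  set c₁ : ℝ := 1 / (2 * 100000) * (1 / 2 : ℝ) ^ (1 / 6 : ℝ) with hc₁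
  have hc₁0 : 0 < c₁ := by positivity
  have E0 : ∀ᶠ x : ℝ in atTop, max z₀ (Real.exp 160000) ≤ x ^ (1 / 2 : ℝ) :=
    (tendsto_rpow_atTop (by norm_num)).eventually_ge_atTop _
  -- the saddle point at the natural scale `⌈2x⌉`
  have E4 : ∀ᶠ x : ℝ in atTop, ∀ y : ℕ, Real.log (⌈2 * x⌉₊ : ℕ) ^ (100000 : ℝ) / 2 ≤ y →
      1 - 1 / 100000 - 1 / 100000 ≤ saddlePoint (⌈2 * x⌉₊ : ℕ) y := by
    have h := le_saddlePoint_of_polylog (K := 100000) (ε := 1 / 100000) (by norm_num) (by norm_num)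
    have T : Tendsto (fun x : ℝ => ⌈2 * x⌉₊) atTop atTop :=
      tendsto_nat_ceil_atTop.comp (Tendsto.const_mul_atTop two_pos tendsto_id)
    exact T.eventually h
  -- the count at the natural scale `⌊z⌋`
  have E5 : ∀ᶠ x : ℝ in atTop, ∀ n : ℕ, x ^ (1 / 2 : ℝ) ≤ (n : ℝ) + 1 →
      (n : ℝ) ^ (1 - 1 / 80000 - 1 / 160000 : ℝ) ≤ ((Nat.smoothNumbersUpTo n (⌊Real.log n ^ (80000 : ℝ)⌋₊ + 1)).card : ℝ) := by
    obtain ⟨N₁, hN₁⟩ := eventually_atTop.1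
      (card_smoothNumbersUpTo_polylog_ge (κ := 80000) (ε := 1 / 160000) (by norm_num) (by norm_num))
    filter_upwards [(tendsto_rpow_atTop (show (0 : ℝ) < 1 / 2 by norm_num)).eventually_ge_atTop ((N₁ : ℝ) + 1)]
      with x hx n hn
    exact hN₁ n (by exact_mod_cast (by linarith : (N₁ : ℝ) ≤ n))
  have EL : ∀ᶠ x : ℝ in atTop, 4 * (100000 : ℝ) * Real.log 3 ≤ Real.log x :=
    Real.tendsto_log_atTop.eventually_ge_atTop _
  filter_upwards [E0, polylog_regime_basic, eventually_loglog_le hc₁0, E4, E5, EL] with x h0 hb h2 h4 h5 hL3 z hz hzx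
  obtain ⟨hx1, hL2, hy2, hyK', hyK, -, hy8x, -, -, h200, -⟩ := hb
  rw [max_le_iff] at h0
  set L : ℝ := Real.log x with hL
  set y : ℕ := ⌊L ^ 100000⌋₊ with hy
  have hx0 : 0 < x := lt_trans one_pos hx1
  have hL1 : 1 ≤ L := by linarith
  have hL0 : 0 ≤ L := by linarith
  have hy2r : (2 : ℝ) ≤ y := by exact_mod_cast hy2
  have hy1 : (1 : ℝ) ≤ y := by linarith
  have hy0 : (0 : ℝ) < y := by linarith
  -- facts at the scale `z`
  have hsqrt0 : 0 < x ^ (1 / 2 : ℝ) := Real.rpow_pos_of_pos hx0 _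
  have hz0 : (0 : ℝ) < z := lt_of_lt_of_le hsqrt0 hz
  have hlogz_le : Real.log z ≤ L := Real.log_le_log hz0 hzx
  have hlogz_ge : L / 2 ≤ Real.log z := by
    have h := Real.log_le_log hsqrt0 hz
    rw [Real.log_rpow hx0] at h
    linarith
  have hlogz0 : 0 ≤ Real.log z := by linarith
  have hz2 : Real.exp 160000 ≤ z := h0.2.trans hz
  have hz1 : 1 < z := lt_of_lt_of_le (Real.one_lt_exp_iff.2 (by norm_num)) hz2
  -- `(log 2z)^8 ≤ 256 L^8 ≤ y`
  have hlog2z : Real.log (2 * z) ≤ 2 * L := by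
    rw [Real.log_mul two_ne_zero hz0.ne']
    have : Real.log 2 ≤ 1 := by have := Real.log_two_lt_d9; linarith
    linarith
  have hlog2z0 : 0 ≤ Real.log (2 * z) := Real.log_nonneg (by linarith)
  have h512 : 512 * L ^ 8 ≤ (y : ℝ) := by
    have hsplit : L ^ 100000 = L ^ 8 * L ^ 99992 := by rw [← pow_add]
    have hbig : (1024 : ℝ) ≤ L ^ 99992 :=
      le_trans (by norm_num) ((pow_le_pow_left₀ zero_le_two hL2 10).trans (pow_le_pow_right₀ hL1 (by norm_num)))
    have : 1024 * L ^ 8 ≤ L ^ 100000 := by rw [hsplit]; nlinarith [pow_nonneg hL0 8]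
    linarith
  have hy8' : Real.log (2 * z) ^ 8 ≤ y := by
    calc Real.log (2 * z) ^ 8 ≤ (2 * L) ^ 8 := pow_le_pow_left₀ hlog2z0 hlog2z 8
      _ = 256 * L ^ 8 := by ring
      _ ≤ y := by nlinarith [pow_nonneg hL0 8]
  -- the saddle point at every real scale `w ∈ (1, 2x]`
  have hα : ∀ w : ℝ, 1 < w → w ≤ 2 * x → 1 - 1 / 10000 ≤ saddlePoint w y := by
    intro w hw1 hw2
    set n : ℕ := ⌈2 * x⌉₊ with hn
    have hwn : w ≤ (n : ℝ) := hw2.trans (Nat.le_ceil _)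
    have hn3 : (n : ℝ) ≤ 3 * x := by
      have := Nat.ceil_lt_add_one (by positivity : 0 ≤ 2 * x); rw [← hn] at this; linarith
    have hn0 : (0 : ℝ) < n := by linarith
    have hlogn : Real.log n ≤ L + Real.log 3 := by
      calc Real.log n ≤ Real.log (3 * x) := Real.log_le_log hn0 hn3
        _ = L + Real.log 3 := by rw [Real.log_mul (by norm_num) hx0.ne']; ring
    have hlogn0 : 0 ≤ Real.log n := Real.log_nonneg (by exact_mod_cast (show 1 ≤ n by
      have : (1 : ℝ) < n := lt_of_lt_of_le hw1 hwn; exact_mod_cast this.le))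
    -- `(log n)^K / 2 ≤ (3/4) L^K ≤ y` (no `linarith` near `(a + b)^100000`: its parser expands powers of sums)
    have hfl : L ^ 100000 - 1 < y := by
      have := Nat.lt_floor_add_one (L ^ 100000); rw [← hy] at this; linarith
    have h4K : (4 : ℝ) ≤ L ^ 100000 := le_trans (by norm_num) ((pow_le_pow_left₀ zero_le_two hL2 2).trans
      (pow_le_pow_right₀ hL1 (by norm_num)))
    have h34 : 3 / 2 * L ^ 100000 / 2 ≤ (y : ℝ) := by linarith
    have hK : Real.log n ^ (100000 : ℝ) / 2 ≤ y := by
      refine le_trans (div_le_div_of_nonneg_right ?_ zero_le_two) h34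
      have h1 : Real.log n ^ (100000 : ℝ) ≤ (L + Real.log 3) ^ (100000 : ℝ) :=
        Real.rpow_le_rpow hlogn0 hlogn (by norm_num)
      have h2 : (L + Real.log 3) ^ (100000 : ℝ) = L ^ (100000 : ℝ) * (1 + Real.log 3 / L) ^ (100000 : ℝ) := by
        rw [← Real.mul_rpow hL0 (by positivity)]; congr 1; field_simp
      have h3 : (1 + Real.log 3 / L) ^ (100000 : ℝ) ≤ 3 / 2 := one_add_div_pow_le (by norm_num) hL3
      have h4 : L ^ (100000 : ℝ) = L ^ 100000 := by
        rw [show (100000 : ℝ) = ((100000 : ℕ) : ℝ) by norm_num, Real.rpow_natCast]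
      rw [h2, h4] at h1
      calc _ ≤ L ^ 100000 * (1 + Real.log 3 / L) ^ (100000 : ℝ) := h1
        _ ≤ L ^ 100000 * (3 / 2) := mul_le_mul_of_nonneg_left h3 (pow_nonneg hL0 _)
        _ = _ := by ring
    have hαn := h4 y hK
    exact le_trans (by norm_num) (hαn.trans (saddlePoint_antitone hw1 hwn hy2))
  refine ⟨h0.1.trans hz, ?_, ?_, h200.trans hz, hα z hz1 (by linarith), ?_, hy8', hα (2 * z) (by linarith) (by linarith)⟩
  · -- `(log z)^8 ≤ y`
    have h8 : Real.log z ^ 8 ≤ L ^ 8 := pow_le_pow_left₀ hlogz0 hlogz_le 8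
    nlinarith [pow_nonneg hL0 8]
  · -- `log y ≤ ½ (log z)^{1/6}`
    have hlogy : Real.log y ≤ 100000 * Real.log L := by
      have h := Real.log_le_log hy0 hyK
      rwa [Real.log_pow] at h
    have hhalf : (1 / 2 * L) ^ (1 / 6 : ℝ) ≤ Real.log z ^ (1 / 6 : ℝ) :=
      Real.rpow_le_rpow (by linarith) (by linarith) (by norm_num)
    calc Real.log y ≤ 100000 * (c₁ * L ^ (1 / 6 : ℝ)) := hlogy.trans (by nlinarith)
      _ = 1 / 2 * ((1 / 2 : ℝ) ^ (1 / 6 : ℝ) * L ^ (1 / 6 : ℝ)) := by rw [hc₁]; ring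
      _ = 1 / 2 * (1 / 2 * L) ^ (1 / 6 : ℝ) := by rw [Real.mul_rpow (by norm_num) hL0]
      _ ≤ 1 / 2 * Real.log z ^ (1 / 6 : ℝ) := by linarith
  · -- `Ψ(z, y) ≥ z^{39999/40000}` via the natural scale `n = ⌊z⌋`
    set n : ℕ := ⌊z⌋₊ with hn
    have hnz : (n : ℝ) ≤ z := Nat.floor_le hz0.le
    have hzn : z < (n : ℝ) + 1 := Nat.lt_floor_add_one z
    have hn1 : (1 : ℝ) ≤ n := by exact_mod_cast Nat.one_le_iff_ne_zero.2 (Nat.pos_iff_ne_zero.1 (Nat.floor_pos.2 hz1.le))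
    have hn0 : (0 : ℝ) < n := by linarith
    have hnhalf : z / 2 ≤ n := by linarith
    have h := h5 n (hz.trans hzn.le)
    -- level monotonicity: `⌊(log n)^{80000}⌋ ≤ y`
    have hk : ⌊Real.log n ^ (80000 : ℝ)⌋₊ + 1 ≤ y + 1 := by
      refine Nat.add_le_add_right (Nat.floor_le_floor ?_) 1
      rw [show (80000 : ℝ) = ((80000 : ℕ) : ℝ) by norm_num, Real.rpow_natCast]
      have hlogn : Real.log n ≤ L := (Real.log_le_log hn0 hnz).trans hlogz_le
      exact (pow_le_pow_left₀ (Real.log_nonneg hn1) hlogn 80000).trans (pow_le_pow_right₀ hL1 (by norm_num))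
    have hmono : ((Nat.smoothNumbersUpTo n (⌊Real.log n ^ (80000 : ℝ)⌋₊ + 1)).card : ℝ) ≤
        ((Nat.smoothNumbersUpTo n (y + 1)).card : ℝ) := by
      exact_mod_cast Finset.card_le_card (Endgame.smoothNumbersUpTo_mono_right n hk)
    refine le_trans ?_ (h.trans hmono)
    -- `z^{39999/40000} ≤ (z/2)^{1 − 3/160000} ≤ n^{1 − 3/160000}`
    have hexp : (1 - 1 / 80000 - 1 / 160000 : ℝ) = 39999 / 40000 + 1 / 160000 := by norm_num
    calc z ^ ((39999 : ℝ) / 40000) = z ^ ((39999 : ℝ) / 40000) * 2 / 2 := by ring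
      _ ≤ z ^ ((39999 : ℝ) / 40000) * z ^ (1 / 160000 : ℝ) / (2 : ℝ) ^ (1 - 1 / 80000 - 1 / 160000 : ℝ) := by
          refine div_le_div₀ (by positivity) (mul_le_mul_of_nonneg_left ?_ (by positivity)) (by positivity)
            ((Real.rpow_le_rpow_of_exponent_le one_le_two (by norm_num)).trans_eq (Real.rpow_one 2))
          calc (2 : ℝ) ≤ Real.exp 1 := by have := Real.exp_one_gt_d9; linarith
            _ = (Real.exp 160000) ^ (1 / 160000 : ℝ) := by rw [← Real.exp_mul]; norm_num
            _ ≤ z ^ (1 / 160000 : ℝ) := Real.rpow_le_rpow (Real.exp_pos _).le hz2 (by norm_num)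
      _ = (z / 2) ^ (1 - 1 / 80000 - 1 / 160000 : ℝ) := by
          rw [hexp, Real.div_rpow hz0.le zero_le_two, Real.rpow_add hz0]
      _ ≤ (n : ℝ) ^ (1 - 1 / 80000 - 1 / 160000 : ℝ) := Real.rpow_le_rpow (by positivity) hnhalf (by norm_num)

end Literature.NumberTheory.Sieve

end
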